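import Mathlib
import Literature.MathematicalPhysics.QuantumLattice.WilsonDiracAP
import Summits.QuantumFields.QCD.Theorems.WilsonQuarkChessboardFlatCellOptimalStubCellGainOfGaugedAllN
import Summits.QuantumFields.QCD.Theorems.WilsonQuarkChessboardFlatCellOptimalStubCellGainTilingGlueAllN
import Summits.QuantumFields.QCD.Theorems.WilsonQuarkChessboardFlatCellOptimalStubCellRegaugeAllN
import Summits.QuantumFields.QCD.Theorems.WilsonQuarkChessboardFlatCellOptimalStubCellGainCoreAllN

/-!
# The local half of `FlatCellOptimal` in norm form, every `N`, every even `L ≥ 4`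
(helper for crux stmt-QuantumFields-9307 `FlatCellOptimal`, line `registered`, stub
`stub_localNormGain_of` (G4 transport), sub-goal `stub_localNormGainAllN` — the transport assembly,
wave 14)

What.  `stub_localNormGainAllN` is the skeleton's `LocalNormGain` with its reducible abbreviations
`dAP`, `tile`, `deficit` expanded (literally the hypothesis `H` of the landed
`…FlatCellOptimal.GaugeOrbit.localFlatOptimum_of_normForm`): there are `η, δ > 0` such that for EVERY
colour number `N`, EVERY even `L ≥ 4`, every `U(N)` field `U` on `(ℤ/L)⁴`, every cell corner `c` and
every mass `-δ < m < δ`, if all plaquettes of the period-2 reflection tiling `tile_c U` have deficit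
`N − Re tr < η`, then `‖det D_AP[tile_c U]‖ ≤ ‖det D_AP[𝟙]‖` (`D_AP[X]` the `r = 1` Wilson–Dirac operator
of the field `X` with the links leaving the last slice negated on all four axes).  With it the lead
discharges the registered skeleton stub `stub_localNormGain_of` by `fun _ _ _ => stub_localNormGainAllN`,
and the local half `LocalFlatOptimum` of the crux becomes a theorem (`localFlatOptimum_of_normGain`).

How.  The all-`N`, `K = 0` cell-gain chain, all four links landed for this crux
(namespace `…FlatCellOptimal.CellGain`):
`stub_cellGainCoreAllN` (the one-cell gain in tiling form for good-gauge cells, every `M ≥ 2`,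
`exp(0 − c_g M⁴ S_cell)`) → `stub_cellRegaugeAllN` (re-gauging: all small-link cells) →
`stub_cellGainTilingGlueAllN` (tiling currency → crux currency on `L = 2M`) →
`stub_cellGainOfGaugedAllN` (link hypothesis → plaquette hypothesis), exactly as in the lead's verified
usage sketch (`LocalHalf.transport`, `LocalHalf.plaquette_form`, abstract in `dAP`/`tile`/`dfc` given by
their defining equations).  Three closing steps (`LocalHalf.normGain`): (i) the tiling `tile_c U` AGREES
with `U` on the `32` links of the closed cell at `c` (`LocalHalf.apply_of_cellLink`: on a cell link the
defining equation takes the forward branch and `c_ν + val(x_ν − c_ν) mod 2 = x_ν` because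
`val(x_ν − c_ν) ≤ 1`), hence on the `24` cell plaquettes (`LocalHalf.plaquetteHolonomy_tile_of_inCell`, the
four links of a cell plaquette are cell links, `CellRegauge.links_of_inCell`); so "all tiling plaquettes
`η`-flat" gives the plaquette hypothesis of `stub_cellGainOfGaugedAllN` for `U`; (ii) deficits are `≥ 0`
on `U(N)` (`CellGainOfGauged.deficit_nonneg`), so `exp(0 − c (L⁴/4) S_cell) ≤ 1`; (iii) the mass window
`-δ < m < δ ⇒ |m| ≤ δ` with `δ := ε` of the chain, `L = 2M` from `Even L`, `4 ≤ L ⇒ 2 ≤ M`.  No case split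
on `N` is needed (every input is stated for all `N`).
References: K. G. Wilson, Phys. Rev. D 10 (1974) 2445; I. Montvay, G. Münster, *Quantum Fields on a
Lattice* §4.2.4, §5.1.1.  The Core input rests, through the one-loop margin, on interval-arithmetic
certificates (computational lane).  Pure theorem file (no definitions).
-/

noncomputable section

open scoped BigOperators Classical Matrix ComplexConjugate
open Finset
open Literature.MathematicalPhysics.QuantumLattice Literature.MathematicalPhysics.QuantumFieldTheory
  Literature.Probability.LatticeModels

namespace Summit.QuantumFields.QCD.Cruxes.FlatCellOptimal.LocalHalf

open Summit.QuantumFields.QCD.Cruxes.FlatCellOptimal.CellGain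
  (stub_cellGainCoreAllN stub_cellRegaugeAllN stub_cellGainTilingGlueAllN stub_cellGainOfGaugedAllN)
open Summit.QuantumFields.QCD.Cruxes.FlatCellOptimal.CellGain.CellGainOfGauged (deficit_nonneg)
open Summit.QuantumFields.QCD.Cruxes.FlatCellOptimal.CellGain.CellRegauge (links_of_inCell)

/-! ### The tiling agrees with the field on the closed cell -/

/-- **On a cell link the tiling is the field itself.**  If `T` satisfies the defining equation of
`tile_c V` and `e = (x, μ)` is a link of the closed unit cell at `c` (all offsets `val (x_ν − c_ν) ≤ 1`,
offset `0` in the link direction), then `T e = V e`: the forward branch is taken and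
`c_ν + (val (x_ν − c_ν) mod 2) = x_ν`. -/
theorem apply_of_cellLink {G : Type*} [Inv G] {L : ℕ} [NeZero L] {T V : GaugeConfig 4 L G}
    {c : Site 4 L}
    (hT : ∀ e : Edge 4 L, T e = if (e.1 e.2 - c e.2).val % 2 = 0
        then V (fun ν => c ν + (((e.1 ν - c ν).val % 2 : ℕ) : ZMod L), e.2)
        else (V (fun ν => c ν + (((Site.shift e.1 e.2 ν - c ν).val % 2 : ℕ) : ZMod L), e.2))⁻¹)
    (e : Edge 4 L) (he : (∀ ν, (e.1 ν - c ν).val ≤ 1) ∧ (e.1 e.2 - c e.2).val = 0) : T e = V e := by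
  rw [hT e, if_pos (by rw [he.2])]
  have hx : (fun ν => c ν + (((e.1 ν - c ν).val % 2 : ℕ) : ZMod L)) = e.1 := by
    funext ν
    rw [Nat.mod_eq_of_lt (Nat.lt_succ_of_le (he.1 ν)), ZMod.natCast_zmod_val, add_sub_cancel]
  rw [hx]

/-- **On a cell plaquette the tiling has the holonomy of the field.**  For the plaquette at `x` in the
plane `(μ, ν)` of the closed unit cell at `c` (`x_μ = c_μ`, `x_ν = c_ν`, transverse coordinates in
`{c, c + 1}`), `U_p(T) = U_p(V)` for any `T` satisfying the defining equation of `tile_c V`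
(its four links are cell links, `CellRegauge.links_of_inCell`). -/
theorem plaquetteHolonomy_tile_of_inCell {G : Type*} [Group G] {L : ℕ} [NeZero L]
    {T V : GaugeConfig 4 L G} {c : Site 4 L}
    (hT : ∀ e : Edge 4 L, T e = if (e.1 e.2 - c e.2).val % 2 = 0
        then V (fun ν => c ν + (((e.1 ν - c ν).val % 2 : ℕ) : ZMod L), e.2)
        else (V (fun ν => c ν + (((Site.shift e.1 e.2 ν - c ν).val % 2 : ℕ) : ZMod L), e.2))⁻¹)
    {x : Site 4 L} {μ ν : Fin 4} (hμν : μ ≠ ν) (h1 : x μ = c μ) (h2 : x ν = c ν)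
    (h3 : ∀ κ, κ ≠ μ → κ ≠ ν → (x κ = c κ ∨ x κ = c κ + 1)) :
    plaquetteHolonomy T x μ ν = plaquetteHolonomy V x μ ν := by
  obtain ⟨l1, l2, l3, l4⟩ := links_of_inCell hμν h1 h2 h3
  unfold plaquetteHolonomy
  rw [apply_of_cellLink hT (x, μ) l1, apply_of_cellLink hT (Site.shift x μ, ν) l2,
    apply_of_cellLink hT (Site.shift x ν, μ) l3, apply_of_cellLink hT (x, ν) l4]

/-! ### The chain Core → Regauge → TilingGlue → OfGauged at `K = 0` (abstract currency) -/

/-- **Transport** (the lead's verified usage sketch, with the Core hypothesis discharged by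
`stub_cellGainCoreAllN`): the link-hypothesis norm gain in the crux currency on every even `L ≥ 4`,
rate `c_g/4`, `K = 0`, abstract in `dAP`/`tile`/`dfc` (defining equations). -/
theorem transport :
    ∃ η c ε : ℝ, 0 < η ∧ 0 < c ∧ 0 < ε ∧ ∀ (N L : ℕ) [NeZero L], Even L → 4 ≤ L → ∀ (m : ℝ), |m| ≤ ε →
      ∀ (dAP : GaugeConfig 4 L (Matrix.unitaryGroup (Fin N) ℂ) → ℂ)
        (tile : Site 4 L → GaugeConfig 4 L (Matrix.unitaryGroup (Fin N) ℂ) →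
          GaugeConfig 4 L (Matrix.unitaryGroup (Fin N) ℂ))
        (dfc : GaugeConfig 4 L (Matrix.unitaryGroup (Fin N) ℂ) → Plaquette 4 L → ℝ),
        (∀ V, dAP V = (wilsonDirac (unitaryFundamentalRep (Fin N) ℂ)
          (fun e => if (e.1 e.2).val + 1 = L then -V e else V e) m 1).det) →
        (∀ (c : Site 4 L) (V : GaugeConfig 4 L (Matrix.unitaryGroup (Fin N) ℂ)) (e : Edge 4 L),
          tile c V e = if (e.1 e.2 - c e.2).val % 2 = 0
            then V (fun ν => c ν + (((e.1 ν - c ν).val % 2 : ℕ) : ZMod L), e.2)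
            else (V (fun ν => c ν + (((Site.shift e.1 e.2 ν - c ν).val % 2 : ℕ) : ZMod L), e.2))⁻¹) →
        (∀ (V : GaugeConfig 4 L (Matrix.unitaryGroup (Fin N) ℂ)) (p : Plaquette 4 L), dfc V p =
          (N : ℝ) - (unitaryFundamentalRep (Fin N) ℂ (plaquetteHolonomy V p.1 p.2.1.1 p.2.1.2)).trace.re) →
        ∀ (W : GaugeConfig 4 L (Matrix.unitaryGroup (Fin N) ℂ)) (cell : Site 4 L),
          (∀ e : Edge 4 L, ((∀ ν, (e.1 ν - cell ν).val ≤ 1) ∧ (e.1 e.2 - cell e.2).val = 0) →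
            (N : ℝ) - ((W e : Matrix.unitaryGroup (Fin N) ℂ) : Matrix (Fin N) (Fin N) ℂ).trace.re ≤ η) →
          ‖dAP (tile cell W)‖ ≤ Real.exp (0 - c * ((L : ℝ) ^ 4 / 4) *
            ∑ p ∈ Finset.univ.filter (fun p : Plaquette 4 L => p.1 p.2.1.1 = cell p.2.1.1 ∧
              p.1 p.2.1.2 = cell p.2.1.2 ∧ ∀ ν, ν ≠ p.2.1.1 → ν ≠ p.2.1.2 → (p.1 ν = cell ν ∨ p.1 ν = cell ν + 1)),
              dfc W p) * ‖dAP 1‖ := by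
  -- adapted from the lead's verified sketch `CellGain.usage_transport` (scratch_regauge_usage.lean)
  obtain ⟨CB, hCB0, hReg⟩ := stub_cellRegaugeAllN
  obtain ⟨ηg, cg, ε, hηg, hcg, hε, hCoreCB⟩ := stub_cellGainCoreAllN CB hCB0
  obtain ⟨η, hη, hRegη⟩ := hReg ηg hηg
  refine ⟨η, cg / 4, ε, hη, by positivity, hε, ?_⟩
  intro N L _ hL h4 m hm dAP tile dfc hdAP htile hdfc W cell hlinks
  obtain ⟨M, hM⟩ := hL
  obtain rfl : L = 2 * M := by omega
  haveI : NeZero M := ⟨by rintro rfl; omega⟩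
  have hM2 : 2 ≤ M := by omega
  refine stub_cellGainTilingGlueAllN 0 cg N M m dAP dfc hdAP hdfc (tile cell W) W _ ?_
  exact hRegη 0 cg N M hM2 m tile htile W cell hlinks
    (fun W' hW' hgg => hCoreCB N M hM2 m hm tile htile W' cell hW' hgg)

/-- **Plaquette form**: `transport` fed into the landed `stub_cellGainOfGaugedAllN` — the norm gain
`‖dAP (tile cell V)‖ ≤ exp(0 − c (L⁴/4) S_cell(V)) ‖dAP 1‖` for every cell whose `24` plaquettes are
`δ₀`-flat, every `N`, every even `L ≥ 4`, `|m| ≤ ε`. -/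
theorem plaquette_form :
    ∃ δ₀ c ε : ℝ, 0 < δ₀ ∧ 0 < c ∧ 0 < ε ∧ ∀ (N L : ℕ) [NeZero L], Even L → 4 ≤ L → ∀ (m : ℝ), |m| ≤ ε →
      ∀ (dAP : GaugeConfig 4 L (Matrix.unitaryGroup (Fin N) ℂ) → ℂ)
        (tile : Site 4 L → GaugeConfig 4 L (Matrix.unitaryGroup (Fin N) ℂ) →
          GaugeConfig 4 L (Matrix.unitaryGroup (Fin N) ℂ))
        (dfc : GaugeConfig 4 L (Matrix.unitaryGroup (Fin N) ℂ) → Plaquette 4 L → ℝ),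
        (∀ V, dAP V = (wilsonDirac (unitaryFundamentalRep (Fin N) ℂ)
          (fun e => if (e.1 e.2).val + 1 = L then -V e else V e) m 1).det) →
        (∀ (c : Site 4 L) (V : GaugeConfig 4 L (Matrix.unitaryGroup (Fin N) ℂ)) (e : Edge 4 L),
          tile c V e = if (e.1 e.2 - c e.2).val % 2 = 0
            then V (fun ν => c ν + (((e.1 ν - c ν).val % 2 : ℕ) : ZMod L), e.2)
            else (V (fun ν => c ν + (((Site.shift e.1 e.2 ν - c ν).val % 2 : ℕ) : ZMod L), e.2))⁻¹) →
        (∀ (V : GaugeConfig 4 L (Matrix.unitaryGroup (Fin N) ℂ)) (p : Plaquette 4 L), dfc V p =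
          (N : ℝ) - (unitaryFundamentalRep (Fin N) ℂ (plaquetteHolonomy V p.1 p.2.1.1 p.2.1.2)).trace.re) →
        ∀ (V : GaugeConfig 4 L (Matrix.unitaryGroup (Fin N) ℂ)) (cell : Site 4 L),
          (∀ p : Plaquette 4 L, (p.1 p.2.1.1 = cell p.2.1.1 ∧ p.1 p.2.1.2 = cell p.2.1.2 ∧
              ∀ ν, ν ≠ p.2.1.1 → ν ≠ p.2.1.2 → (p.1 ν = cell ν ∨ p.1 ν = cell ν + 1)) → dfc V p < δ₀) →
          ‖dAP (tile cell V)‖ ≤ Real.exp (0 - c * ((L : ℝ) ^ 4 / 4) *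
            ∑ p ∈ Finset.univ.filter (fun p : Plaquette 4 L => p.1 p.2.1.1 = cell p.2.1.1 ∧
              p.1 p.2.1.2 = cell p.2.1.2 ∧ ∀ ν, ν ≠ p.2.1.1 → ν ≠ p.2.1.2 → (p.1 ν = cell ν ∨ p.1 ν = cell ν + 1)),
              dfc V p) * ‖dAP 1‖ := by
  -- adapted from the lead's verified sketch `CellGain.usage_plaquette_form` (scratch_regauge_usage.lean)
  obtain ⟨η, c, ε, hη, hc, hε, hT⟩ := transport
  obtain ⟨δ₀, hδ₀, hOG⟩ := stub_cellGainOfGaugedAllN η hη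
  refine ⟨δ₀, c, ε, hδ₀, hc, hε, ?_⟩
  intro N L _ hL h4 m hm dAP tile dfc hdAP htile hdfc V cell hgood
  exact hOG 0 c N L hL h4 m dAP tile dfc hdAP htile hdfc V cell _
    (fun W hW => hT N L hL h4 m hm dAP tile dfc hdAP htile hdfc W cell hW) hgood

/-- **The local half in norm form, abstract currency.**  `η := δ₀`, `δ := ε` of `plaquette_form`; the
flatness of ALL plaquettes of the tiling `tile c U` gives the flatness of the cell plaquettes of `U`
(`plaquetteHolonomy_tile_of_inCell`), and `exp(0 − c (L⁴/4) S_cell(U)) ≤ 1` since `S_cell(U) ≥ 0`. -/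
theorem normGain :
    ∃ η δ : ℝ, 0 < η ∧ 0 < δ ∧ ∀ (N L : ℕ) [NeZero L], Even L → 4 ≤ L → ∀ (m : ℝ), |m| ≤ δ →
      ∀ (dAP : GaugeConfig 4 L (Matrix.unitaryGroup (Fin N) ℂ) → ℂ)
        (tile : Site 4 L → GaugeConfig 4 L (Matrix.unitaryGroup (Fin N) ℂ) →
          GaugeConfig 4 L (Matrix.unitaryGroup (Fin N) ℂ)),
        (∀ V, dAP V = (wilsonDirac (unitaryFundamentalRep (Fin N) ℂ)
          (fun e => if (e.1 e.2).val + 1 = L then -V e else V e) m 1).det) →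
        (∀ (c : Site 4 L) (V : GaugeConfig 4 L (Matrix.unitaryGroup (Fin N) ℂ)) (e : Edge 4 L),
          tile c V e = if (e.1 e.2 - c e.2).val % 2 = 0
            then V (fun ν => c ν + (((e.1 ν - c ν).val % 2 : ℕ) : ZMod L), e.2)
            else (V (fun ν => c ν + (((Site.shift e.1 e.2 ν - c ν).val % 2 : ℕ) : ZMod L), e.2))⁻¹) →
        ∀ (U : GaugeConfig 4 L (Matrix.unitaryGroup (Fin N) ℂ)) (c : Site 4 L),
          (∀ (x : Site 4 L) (i j : Fin 4), (N : ℝ) -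
            (unitaryFundamentalRep (Fin N) ℂ (plaquetteHolonomy (tile c U) x i j)).trace.re < η) →
          ‖dAP (tile c U)‖ ≤ ‖dAP 1‖ := by
  obtain ⟨δ₀, c₁, ε, hδ₀, hc₁, hε, hPF⟩ := plaquette_form
  refine ⟨δ₀, ε, hδ₀, hε, ?_⟩
  intro N L _ hL h4 m hm dAP tile hdAP htile U c hflat
  -- (i) the cell plaquettes of `U` are plaquettes of the tiling
  have hgood : ∀ p : Plaquette 4 L, (p.1 p.2.1.1 = c p.2.1.1 ∧ p.1 p.2.1.2 = c p.2.1.2 ∧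
      ∀ ν, ν ≠ p.2.1.1 → ν ≠ p.2.1.2 → (p.1 ν = c ν ∨ p.1 ν = c ν + 1)) →
      (fun (V : GaugeConfig 4 L (Matrix.unitaryGroup (Fin N) ℂ)) (p : Plaquette 4 L) =>
        (N : ℝ) - (unitaryFundamentalRep (Fin N) ℂ (plaquetteHolonomy V p.1 p.2.1.1 p.2.1.2)).trace.re)
        U p < δ₀ := by
    rintro p ⟨h1, h2, h3⟩
    show (N : ℝ) - (unitaryFundamentalRep (Fin N) ℂ (plaquetteHolonomy U p.1 p.2.1.1 p.2.1.2)).trace.re < δ₀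
    rw [← plaquetteHolonomy_tile_of_inCell (T := tile c U) (htile c U) (ne_of_lt p.2.2) h1 h2 h3]
    exact hflat p.1 p.2.1.1 p.2.1.2
  -- the chain, in plaquette form
  have key := hPF N L hL h4 m hm dAP tile
    (fun (V : GaugeConfig 4 L (Matrix.unitaryGroup (Fin N) ℂ)) (p : Plaquette 4 L) =>
      (N : ℝ) - (unitaryFundamentalRep (Fin N) ℂ (plaquetteHolonomy V p.1 p.2.1.1 p.2.1.2)).trace.re)
    hdAP htile (fun _ _ => rfl) U c hgood
  -- (ii) `exp(0 − c (L⁴/4) S) ≤ 1`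
  have hS : 0 ≤ ∑ p ∈ Finset.univ.filter (fun p : Plaquette 4 L => p.1 p.2.1.1 = c p.2.1.1 ∧
      p.1 p.2.1.2 = c p.2.1.2 ∧ ∀ ν, ν ≠ p.2.1.1 → ν ≠ p.2.1.2 → (p.1 ν = c ν ∨ p.1 ν = c ν + 1)),
      (fun (V : GaugeConfig 4 L (Matrix.unitaryGroup (Fin N) ℂ)) (p : Plaquette 4 L) =>
        (N : ℝ) - (unitaryFundamentalRep (Fin N) ℂ (plaquetteHolonomy V p.1 p.2.1.1 p.2.1.2)).trace.re)
        U p :=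
    Finset.sum_nonneg fun p _ => deficit_nonneg _
  have hexp : Real.exp (0 - c₁ * ((L : ℝ) ^ 4 / 4) * ∑ p ∈ Finset.univ.filter (fun p : Plaquette 4 L =>
      p.1 p.2.1.1 = c p.2.1.1 ∧ p.1 p.2.1.2 = c p.2.1.2 ∧
        ∀ ν, ν ≠ p.2.1.1 → ν ≠ p.2.1.2 → (p.1 ν = c ν ∨ p.1 ν = c ν + 1)),
      (fun (V : GaugeConfig 4 L (Matrix.unitaryGroup (Fin N) ℂ)) (p : Plaquette 4 L) =>
        (N : ℝ) - (unitaryFundamentalRep (Fin N) ℂ (plaquetteHolonomy V p.1 p.2.1.1 p.2.1.2)).trace.re)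
        U p) ≤ 1 := by
    rw [Real.exp_le_one_iff, sub_nonpos]
    exact mul_nonneg (mul_nonneg hc₁.le (by positivity)) hS
  exact key.trans (mul_le_of_le_one_left (norm_nonneg _) hexp)

/-- **Sub-goal `stub_localNormGainAllN` (G4, wave 14) — the local half of `FlatCellOptimal` in norm
form, every `N`, every even `L ≥ 4`** (the skeleton's `LocalNormGain` with `dAP`, `tile`, `deficit`
expanded; the hypothesis `H` of `GaugeOrbit.localFlatOptimum_of_normForm`): `normGain` at the crux's
own `dAP`, `tile` (defining equations by `rfl`) and the two-sided mass window `-δ < m < δ ⇒ |m| ≤ δ`. -/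
theorem stub_localNormGainAllN : ∃ η : ℝ, 0 < η ∧ ∃ δ : ℝ, 0 < δ ∧ ∀ (N L : ℕ) [NeZero L], Even L → 4 ≤ L → ∀ (U : GaugeConfig 4 L (Matrix.unitaryGroup (Fin N) ℂ)) (c : Site 4 L) (m : ℝ), -δ < m → m < δ → (∀ (x : Site 4 L) (i j : Fin 4), (N : ℝ) - ((unitaryFundamentalRep (Fin N) ℂ) (plaquetteHolonomy (fun e : Edge 4 L => if (e.1 e.2 - c e.2).val % 2 = 0 then U (fun ν => c ν + (((e.1 ν - c ν).val % 2 : ℕ) : ZMod L), e.2) else (U (fun ν => c ν + (((Site.shift e.1 e.2 ν - c ν).val % 2 : ℕ) : ZMod L), e.2))⁻¹) x i j)).trace.re < η) → ‖(wilsonDirac (unitaryFundamentalRep (Fin N) ℂ) (fun e : Edge 4 L => if (e.1 e.2).val + 1 = L then -((fun e : Edge 4 L => if (e.1 e.2 - c e.2).val % 2 = 0 then U (fun ν => c ν + (((e.1 ν - c ν).val % 2 : ℕ) : ZMod L), e.2) else (U (fun ν => c ν + (((Site.shift e.1 e.2 ν - c ν).val % 2 : ℕ) : ZMod L), e.2))⁻¹)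 e) else (fun e : Edge 4 L => if (e.1 e.2 - c e.2).val % 2 = 0 then U (fun ν => c ν + (((e.1 ν - c ν).val % 2 : ℕ) : ZMod L), e.2) else (U (fun ν => c ν + (((Site.shift e.1 e.2 ν - c ν).val % 2 : ℕ) : ZMod L), e.2))⁻¹) e) m 1).det‖ ≤ ‖(wilsonDirac (unitaryFundamentalRep (Fin N) ℂ) (fun e : Edge 4 L => if (e.1 e.2).val + 1 = L then -(1 : GaugeConfig 4 L (Matrix.unitaryGroup (Fin N) ℂ)) e else (1 : GaugeConfig 4 L (Matrix.unitaryGroup (Fin N) ℂ)) e) m 1).det‖ := by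
  obtain ⟨η, δ, hη, hδ, H⟩ := normGain
  refine ⟨η, hη, δ, hδ, ?_⟩
  intro N L _ hL h4 U c m hm₁ hm₂ hflat
  exact H N L hL h4 m (abs_le.2 ⟨hm₁.le, hm₂.le⟩)
    (fun V => (wilsonDirac (unitaryFundamentalRep (Fin N) ℂ)
      (fun e => if (e.1 e.2).val + 1 = L then -V e else V e) m 1).det)
    (fun c V e => if (e.1 e.2 - c e.2).val % 2 = 0
      then V (fun ν => c ν + (((e.1 ν - c ν).val % 2 : ℕ) : ZMod L), e.2)
      else (V (fun ν => c ν + (((Site.shift e.1 e.2 ν - c ν).val % 2 : ℕ) : ZMod L), e.2))⁻¹)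
    (fun _ => rfl) (fun _ _ _ => rfl) U c hflat

end Summit.QuantumFields.QCD.Cruxes.FlatCellOptimal.LocalHalf

end
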